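import Summits.QuantumFields.YangMills.Theorems.VirialFluxGapHaarIBP
import Summits.QuantumFields.YangMills.Theorems.VirialFluxGapPeriodicVolumeFloor
import Summits.QuantumFields.YangMills.Theorems.LuscherReductionRunningReductionTraceFormulaAveraging
import HarnessLib

/-!
# Route `VirialFluxGap` (YangMills): the Gibbs ∕ virial pairing ON THE RING SPACE and the VIRIAL MEAN BOUND for the ring deficit

Toward the deciding crux `VirialFluxGap.PeriodicSoftness` (item stmt-QuantumFields-24141).  The ring space
`Ω_L = (Fin 2L → GaugeConfig 3 L SU(2)) × (Site 3 L → SU(2))` is a (pointwise) compact group and the a-priori measure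
✓`RingDeficit.ringMeasure L` is a finite product of Haar probabilities, hence RIGHT (and left) INVARIANT for this group structure
(§1).  Therefore the generic engine ✓`HaarIBP` applies verbatim: for any finite family of translation curves `γ_j : ℝ → Ω_L`
(`γ_j 0 = 1`; e.g. `γ(s) = mulSingle_v(exp(s·E))`, one `SU(2)` variable `v` turned along `E ∈ 𝔰𝔲(2)`) and coefficient functions
`φ_j` — i.e. for the vector field `X = Σ_j φ_j ∂_j` —

* §2 ★★ `ring_pairing` — `∫ (Σ_j ∂_jφ_j) e^{−βF_z} dμ_L = β ∫ (Σ_j φ_j ∂_jF_z) e^{−βF_z} dμ_L` («`⟨div X⟩ = β⟨X·F⟩`», every sector `z`,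
  `β ≥ 0`; the deficit's own bounds `0 ≤ F_z`, measurability are discharged here);
* §3 ★★ `ring_virial_gibbsMean_le` — if moreover `X·F_z ≥ 2(1−ε)F_z − E` and `div X ≤ D` pointwise, then
  `β⟨F_z⟩_β ≤ (D + β⟨E⟩_β) / (2(1−ε))` (✓`HaarIBP.virial_gibbsMean_le`);
* §4 ★★ `ring_gibbsMean_error_le` — for an error term `E ≤ E_max` vanishing on `{F₀ < t₁}` (`0 < t₁ ≤ 2`), the FLOOR
  ✓`VolumeFloor.exp_le_ringMeasure_real_deficit_le` gives `⟨E⟩_β ≤ E_max · exp(−βt₁/2 + 150L⁵(1 + log(2/t₁)))` — exponentially small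
  once `βt₁ ≫ L⁵ log(1/t₁)`;
* §5 ★★★ `ring_virial_mean_bound` — the two combined: the β-explicit VIRIAL MEAN BOUND
  `β⟨F₀⟩_β ≤ (D + β·E_max·exp(−βt₁/2 + 150L⁵(1 + log(2/t₁)))) / (2(1−ε))`.
With `D = 18L⁴ − 2c′`, `ε ≤ L⁻⁴/20`, `t₁ = 1/poly(L)` this is `β⟨F₀⟩_β ≤ 9L⁴ − c` for `β ≥ poly(L)`, i.e. `PeriodicSoftness` on every
Laplace window — modulo the EULER FIELD near the toron valley (the geometric heart, NOT in this file).

HONEST FRAMING: instantiation ∕ bookkeeping; no stub / crux / rung / summit is closed; ⟨24141⟩ stays OPEN; the Yang–Mills mass gap is NOT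
proved; no summit is proved by a line.  THEOREMS ONLY (0 `def`, 0 `sorry`), standard axioms.  Width seat `ym-line-sfw-p2-w3` g58
(cell ym-idea-1, free hands), `--supports stmt-QuantumFields-24141`.
References: [cite: Griffiths1964]; [cite: MontvayMunster1994, (3.145)]; [cite: Luscher1983, §2].
-/

set_option autoImplicit false

noncomputable section

open MeasureTheory Set Filter Metric
open scoped Topology BigOperators
open Literature.MathematicalPhysics.QuantumFieldTheory hiding SU2
open Literature.MathematicalPhysics.QuantumLattice

namespace Summit.QuantumFields.YangMills.Theorems.VirialFluxGap.RingIBP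

open Summit.QuantumFields.YangMills.Theorems.FemtoTransferGap
open Summit.QuantumFields.YangMills.Theorems.FemtoTransferGap.TT
open Summit.QuantumFields.YangMills.Theorems.VirialFluxGap.RingDeficit
open Summit.QuantumFields.YangMills.Theorems.VirialFluxGap.HaarIBP
open Summit.QuantumFields.YangMills.Theorems.VirialFluxGap.VolumeFloor

variable {L : ℕ} [NeZero L]

/-! ## §1 The ring measure is right and left invariant -/

/-- `MeasurableMul` for a binary product of measurable multiplications (componentwise). [folklore] -/
theorem measurableMul_prod {α β : Type*} [Mul α] [Mul β] [MeasurableSpace α] [MeasurableSpace β]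
    [MeasurableMul α] [MeasurableMul β] : MeasurableMul (α × β) where
  measurable_const_mul c :=
    ((measurable_const_mul c.1).comp measurable_fst).prodMk ((measurable_const_mul c.2).comp measurable_snd)
  measurable_mul_const c :=
    ((measurable_mul_const c.1).comp measurable_fst).prodMk ((measurable_mul_const c.2).comp measurable_snd)

omit [NeZero L] in
/-- The ring space has measurable (pointwise) multiplication. [folklore] -/
theorem measurableMul_ringSpace :
    MeasurableMul ((Fin (2 * L - 1 + 1) → GaugeConfig 3 L SU2) × (Site 3 L → SU2)) :=
  measurableMul_prod

/-- The slice a-priori measure (product Haar) is right invariant for the pointwise group structure. [folklore] -/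
theorem isMulRightInvariant_configMeasure : (configMeasure SU2 L).IsMulRightInvariant := by
  unfold configMeasure; exact Measure.pi.isMulRightInvariant _

/-- The slice a-priori measure (product Haar) is left invariant. [folklore] -/
theorem isMulLeftInvariant_configMeasure : (configMeasure SU2 L).IsMulLeftInvariant := by
  unfold configMeasure; exact Measure.pi.isMulLeftInvariant _

/-- The gauge (seam) measure is left invariant. [folklore] -/
theorem isMulLeftInvariant_gaugeMeasure : (gaugeMeasure L).IsMulLeftInvariant := by
  unfold gaugeMeasure; exact Measure.pi.isMulLeftInvariant _

/-- ★ **The ring measure is right invariant** (pointwise group structure of the ring space). [folklore] -/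
theorem isMulRightInvariant_ringMeasure : (ringMeasure L).IsMulRightInvariant := by
  haveI := isProbabilityMeasure_gaugeMeasure (L := L)
  haveI := isMulRightInvariant_gaugeMeasure (L := L)
  haveI : (configMeasure SU2 L).IsMulRightInvariant := isMulRightInvariant_configMeasure
  haveI : (Measure.pi fun _ : Fin (2 * L - 1 + 1) => configMeasure SU2 L).IsMulRightInvariant :=
    Measure.pi.isMulRightInvariant _
  unfold ringMeasure
  exact Measure.prod.instIsMulRightInvariant

/-- ★ **The ring measure is left invariant.** [folklore] -/
theorem isMulLeftInvariant_ringMeasure : (ringMeasure L).IsMulLeftInvariant := by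
  haveI := isProbabilityMeasure_gaugeMeasure (L := L)
  haveI : (gaugeMeasure L).IsMulLeftInvariant := isMulLeftInvariant_gaugeMeasure
  haveI : (configMeasure SU2 L).IsMulLeftInvariant := isMulLeftInvariant_configMeasure
  haveI : (Measure.pi fun _ : Fin (2 * L - 1 + 1) => configMeasure SU2 L).IsMulLeftInvariant :=
    Measure.pi.isMulLeftInvariant _
  unfold ringMeasure
  exact Measure.prod.instIsMulLeftInvariant

/-- Bounded strongly measurable functions are integrable against the Gibbs weight of the deficit (`β ≥ 0`). [folklore] -/
theorem integrable_mul_exp_of_bound (z : Fin 3 → Bool) {β : ℝ} (hβ : 0 ≤ β)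
    {h : (Fin (2 * L - 1 + 1) → GaugeConfig 3 L SU2) × (Site 3 L → SU2) → ℝ} {C : ℝ}
    (hm : StronglyMeasurable h) (hb : ∀ x, |h x| ≤ C) :
    Integrable (fun x => h x * Real.exp (-(β * ringDeficit L z x))) (ringMeasure L) := by
  haveI := isProbabilityMeasure_ringMeasure (L := L)
  have hem : Measurable fun x => Real.exp (-(β * ringDeficit L z x)) := ((measurable_ringDeficit z).const_mul β).neg.exp
  refine (integrable_const C).mono' (hm.mul hem.stronglyMeasurable).aestronglyMeasurable (Eventually.of_forall fun x => ?_)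
  have hexp_le : Real.exp (-(β * ringDeficit L z x)) ≤ 1 := by
    rw [Real.exp_le_one_iff]
    have := mul_nonneg hβ (ringDeficit_nonneg z x)
    linarith
  rw [Real.norm_eq_abs, abs_mul, abs_of_pos (Real.exp_pos _)]
  calc |h x| * Real.exp (-(β * ringDeficit L z x)) ≤ C * 1 :=
        mul_le_mul (hb x) hexp_le (Real.exp_pos _).le ((abs_nonneg _).trans (hb x))
    _ = C := mul_one C

/-! ## §2 The Gibbs ∕ virial pairing on the ring space -/

/-- ★★ **Gibbs ∕ virial pairing on the ring space.**  For every sector `z`, every `β ≥ 0`, every finite family of translation curves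
`γ_j : ℝ → Ω_L` with `γ_j 0 = 1` and coefficient functions `φ_j` (bounded measurable, differentiable along their own curve for `|s| < ε₀`
with bounded, strongly measurable derivative `Dφ_j`), and derivatives `DF_j` of the deficit `F_z` along the curves (bounded, strongly
measurable at `s = 0`):  `∫ (Σ_j Dφ_j 0) e^{−βF_z} dμ_L = β ∫ (Σ_j φ_j · DF_j 0) e^{−βF_z} dμ_L`. [cite: Griffiths1964] -/
theorem ring_pairing (z : Fin 3 → Bool) {J : Type*} (s : Finset J)
    {γ : J → ℝ → (Fin (2 * L - 1 + 1) → GaugeConfig 3 L SU2) × (Site 3 L → SU2)} (hγ : ∀ j ∈ s, γ j 0 = 1)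
    {φ : J → (Fin (2 * L - 1 + 1) → GaugeConfig 3 L SU2) × (Site 3 L → SU2) → ℝ} (hφm : ∀ j ∈ s, Measurable (φ j))
    {Cφ : J → ℝ} (hφb : ∀ j ∈ s, ∀ x, |φ j x| ≤ Cφ j)
    {Dφ DF : J → ℝ → (Fin (2 * L - 1 + 1) → GaugeConfig 3 L SU2) × (Site 3 L → SU2) → ℝ} {ε₀ : ℝ} (hε₀ : 0 < ε₀)
    (hDφ : ∀ j ∈ s, ∀ x, ∀ t ∈ ball (0 : ℝ) ε₀, HasDerivAt (fun s' => φ j (x * γ j s')) (Dφ j t x) t)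
    (hDF : ∀ j ∈ s, ∀ x, ∀ t ∈ ball (0 : ℝ) ε₀, HasDerivAt (fun s' => ringDeficit L z (x * γ j s')) (DF j t x) t)
    {Bφ BF : J → ℝ} (hDφb : ∀ j ∈ s, ∀ x, ∀ t ∈ ball (0 : ℝ) ε₀, |Dφ j t x| ≤ Bφ j)
    (hDFb : ∀ j ∈ s, ∀ x, ∀ t ∈ ball (0 : ℝ) ε₀, |DF j t x| ≤ BF j)
    (hDφm : ∀ j ∈ s, StronglyMeasurable (Dφ j 0)) (hDFm : ∀ j ∈ s, StronglyMeasurable (DF j 0)) {β : ℝ} (hβ : 0 ≤ β) :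
    ∫ x, (∑ j ∈ s, Dφ j 0 x) * Real.exp (-(β * ringDeficit L z x)) ∂(ringMeasure L) =
      β * ∫ x, (∑ j ∈ s, φ j x * DF j 0 x) * Real.exp (-(β * ringDeficit L z x)) ∂(ringMeasure L) := by
  haveI := isProbabilityMeasure_ringMeasure (L := L)
  haveI := isMulRightInvariant_ringMeasure (L := L)
  haveI := measurableMul_ringSpace (L := L)
  exact sum_integral_deriv_mul_exp_eq_of_mulRight (ringMeasure L) s hγ hφm (measurable_ringDeficit z) hφb
    (ringDeficit_nonneg z) hε₀ hDφ hDF hDφb hDFb hDφm hDFm hβ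

/-! ## §3 The virial mean inequality for the ring deficit -/

/-- ★★ **Virial mean inequality for the ring deficit.**  Under the hypotheses of `ring_pairing`, if the field dominates twice the
deficit up to an error term, `Σ_j φ_j·DF_j 0 ≥ 2(1−ε)F_z − E` (`E` bounded measurable), and its divergence is bounded, `Σ_j Dφ_j 0 ≤ D`,
then `β⟨F_z⟩_β ≤ (D + β⟨E⟩_β)/(2(1−ε))`. [cite: Griffiths1964] -/
theorem ring_virial_gibbsMean_le (z : Fin 3 → Bool) {J : Type*} (s : Finset J)
    {γ : J → ℝ → (Fin (2 * L - 1 + 1) → GaugeConfig 3 L SU2) × (Site 3 L → SU2)} (hγ : ∀ j ∈ s, γ j 0 = 1)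
    {φ : J → (Fin (2 * L - 1 + 1) → GaugeConfig 3 L SU2) × (Site 3 L → SU2) → ℝ} (hφm : ∀ j ∈ s, Measurable (φ j))
    {Cφ : J → ℝ} (hφb : ∀ j ∈ s, ∀ x, |φ j x| ≤ Cφ j)
    {Dφ DF : J → ℝ → (Fin (2 * L - 1 + 1) → GaugeConfig 3 L SU2) × (Site 3 L → SU2) → ℝ} {ε₀ : ℝ} (hε₀ : 0 < ε₀)
    (hDφ : ∀ j ∈ s, ∀ x, ∀ t ∈ ball (0 : ℝ) ε₀, HasDerivAt (fun s' => φ j (x * γ j s')) (Dφ j t x) t)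
    (hDF : ∀ j ∈ s, ∀ x, ∀ t ∈ ball (0 : ℝ) ε₀, HasDerivAt (fun s' => ringDeficit L z (x * γ j s')) (DF j t x) t)
    {Bφ BF : J → ℝ} (hDφb : ∀ j ∈ s, ∀ x, ∀ t ∈ ball (0 : ℝ) ε₀, |Dφ j t x| ≤ Bφ j)
    (hDFb : ∀ j ∈ s, ∀ x, ∀ t ∈ ball (0 : ℝ) ε₀, |DF j t x| ≤ BF j)
    (hDφm : ∀ j ∈ s, StronglyMeasurable (Dφ j 0)) (hDFm : ∀ j ∈ s, StronglyMeasurable (DF j 0)) {β : ℝ} (hβ : 0 ≤ β)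
    {E : (Fin (2 * L - 1 + 1) → GaugeConfig 3 L SU2) × (Site 3 L → SU2) → ℝ} (hEm : Measurable E) {CE : ℝ} (hEb : ∀ x, |E x| ≤ CE)
    {D ε : ℝ} (hε : ε < 1)
    (hXF : ∀ x, 2 * (1 - ε) * ringDeficit L z x - E x ≤ ∑ j ∈ s, φ j x * DF j 0 x)
    (hdiv : ∀ x, ∑ j ∈ s, Dφ j 0 x ≤ D) :
    β * (∫ x, ringDeficit L z x * Real.exp (-(β * ringDeficit L z x)) ∂(ringMeasure L)) /
        (∫ x, Real.exp (-(β * ringDeficit L z x)) ∂(ringMeasure L)) ≤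
      (D + β * (∫ x, E x * Real.exp (-(β * ringDeficit L z x)) ∂(ringMeasure L)) /
        (∫ x, Real.exp (-(β * ringDeficit L z x)) ∂(ringMeasure L))) / (2 * (1 - ε)) := by
  haveI := isProbabilityMeasure_ringMeasure (L := L)
  have hpair := ring_pairing z s hγ hφm hφb hε₀ hDφ hDF hDφb hDFb hDφm hDFm hβ
  -- integrability bookkeeping: every weighted function is bounded measurable on a probability space
  have hgm : StronglyMeasurable fun x => ∑ j ∈ s, φ j x * DF j 0 x := by
    have h : ∀ j ∈ s, StronglyMeasurable (fun x => φ j x * DF j 0 x) := fun j hj => (hφm j hj).stronglyMeasurable.mul (hDFm j hj)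
    have heq : (fun x => ∑ j ∈ s, φ j x * DF j 0 x) = ∑ j ∈ s, (fun x => φ j x * DF j 0 x) := by
      funext x; simp only [Finset.sum_apply]
    rw [heq]
    exact Finset.stronglyMeasurable_sum s h
  have hgb : ∀ x, |∑ j ∈ s, φ j x * DF j 0 x| ≤ ∑ j ∈ s, Cφ j * BF j := fun x => by
    refine (Finset.abs_sum_le_sum_abs _ _).trans (Finset.sum_le_sum fun j hj => ?_)
    rw [abs_mul]
    exact mul_le_mul (hφb j hj x) (hDFb j hj x 0 (mem_ball_self hε₀)) (abs_nonneg _) ((abs_nonneg _).trans (hφb j hj x))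
  have hdm : StronglyMeasurable fun x => ∑ j ∈ s, Dφ j 0 x := by
    have heq : (fun x => ∑ j ∈ s, Dφ j 0 x) = ∑ j ∈ s, Dφ j 0 := by
      funext x; simp only [Finset.sum_apply]
    rw [heq]
    exact Finset.stronglyMeasurable_sum s fun j hj => hDφm j hj
  have hdb : ∀ x, |∑ j ∈ s, Dφ j 0 x| ≤ ∑ j ∈ s, Bφ j := fun x =>
    (Finset.abs_sum_le_sum_abs _ _).trans (Finset.sum_le_sum fun j hj => hDφb j hj x 0 (mem_ball_self hε₀))
  have hEb' : ∀ x, |E x| ≤ CE := hEb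
  exact virial_gibbsMean_le (ringMeasure L) hβ hε hpair hXF hdiv (integrable_ringDeficit_mul_exp β z)
    (integrable_mul_exp_of_bound z hβ hEm.stronglyMeasurable hEb') (integrable_mul_exp_of_bound z hβ hgm hgb)
    (integrable_mul_exp_of_bound z hβ hdm hdb) (integrable_exp_neg_mul_ringDeficit β z)
    (integral_exp_neg_mul_ringDeficit_pos β z)

/-! ## §4 The error term against the volume floor -/

/-- ★★ **Gibbs mean of a supported error term against the floor** (zero-flux sector): for `E ≤ E_max` vanishing on `{F₀ < t₁}`,
`0 < t₁ ≤ 2`, `β ≥ 0`: `⟨E⟩_β ≤ E_max · exp(−βt₁/2 + 150·L⁵·(1 + log(2/t₁)))`. [cite: Luscher1983, §2] -/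
theorem ring_gibbsMean_error_le {E : (Fin (2 * L - 1 + 1) → GaugeConfig 3 L SU2) × (Site 3 L → SU2) → ℝ}
    {β t₁ Emax : ℝ} (hβ : 0 ≤ β) (ht₁ : 0 < t₁) (ht₁2 : t₁ ≤ 2) (hEmax : 0 ≤ Emax)
    (hEle : ∀ x, E x ≤ Emax) (hEsupp : ∀ x, ringDeficit L (fun _ => false) x < t₁ → E x = 0) :
    (∫ x, E x * Real.exp (-(β * ringDeficit L (fun _ => false) x)) ∂(ringMeasure L)) /
        (∫ x, Real.exp (-(β * ringDeficit L (fun _ => false) x)) ∂(ringMeasure L)) ≤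
      Emax * Real.exp (-(β * t₁ / 2) + 150 * (L : ℝ) ^ 5 * (1 + Real.log (2 / t₁))) := by
  haveI := isProbabilityMeasure_ringMeasure (L := L)
  have hs0 : 0 < t₁ / 2 := by linarith
  have hs1 : t₁ / 2 ≤ 1 := by linarith
  have hfloor := exp_le_ringMeasure_real_deficit_le (L := L) hs0 hs1
  have hpos : 0 < (ringMeasure L).real {x | ringDeficit L (fun _ => false) x ≤ t₁ / 2} := (Real.exp_pos _).trans_le hfloor
  have h := gibbsMean_error_le (ringMeasure L) (measurable_ringDeficit _) hβ hEmax hEle hEsupp (ringDeficit_nonneg _)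
    (s := t₁ / 2) hpos
  have hinv : Real.log (2 / t₁) = Real.log (t₁ / 2)⁻¹ := by rw [inv_div]
  have hm : Real.exp (-(150 * (L : ℝ) ^ 5 * (1 + Real.log (2 / t₁)))) ≤
      (ringMeasure L).real {x | ringDeficit L (fun _ => false) x ≤ t₁ / 2} := by rw [hinv]; exact hfloor
  calc (∫ x, E x * Real.exp (-(β * ringDeficit L (fun _ => false) x)) ∂(ringMeasure L)) /
        (∫ x, Real.exp (-(β * ringDeficit L (fun _ => false) x)) ∂(ringMeasure L))
      ≤ Emax * Real.exp (-(β * (t₁ - t₁ / 2))) * (ringMeasure L).real univ /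
          (ringMeasure L).real {x | ringDeficit L (fun _ => false) x ≤ t₁ / 2} := h
    _ = Emax * Real.exp (-(β * t₁ / 2)) / (ringMeasure L).real {x | ringDeficit L (fun _ => false) x ≤ t₁ / 2} := by
        rw [probReal_univ, mul_one, show -(β * (t₁ - t₁ / 2)) = -(β * t₁ / 2) by ring]
    _ ≤ Emax * Real.exp (-(β * t₁ / 2)) / Real.exp (-(150 * (L : ℝ) ^ 5 * (1 + Real.log (2 / t₁)))) :=
        div_le_div_of_nonneg_left (by positivity) (Real.exp_pos _) hm
    _ = Emax * Real.exp (-(β * t₁ / 2) + 150 * (L : ℝ) ^ 5 * (1 + Real.log (2 / t₁))) := by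
        rw [Real.exp_add, div_eq_mul_inv, ← Real.exp_neg, neg_neg, mul_assoc]

/-! ## §5 The β-explicit virial mean bound -/

/-- ★★★ **Virial mean bound for the zero-flux ring deficit, β-explicit.**  Given a coefficient field `X = Σ_j φ_j ∂_j` on the ring space
(hypotheses of `ring_pairing`, sector `z = 0`) with `X·F₀ ≥ 2(1−ε)F₀ − E`, where the error term `0 ≤ E ≤ E_max` vanishes on
`{F₀ < t₁}` (`0 < t₁ ≤ 2`), and `div X ≤ D`, then for every `β ≥ 0`
`β⟨F₀⟩_β ≤ (D + β·E_max·exp(−βt₁/2 + 150L⁵(1 + log(2/t₁)))) / (2(1−ε))`.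
With `D = 18L⁴ − 2c′`, `ε ≤ L⁻⁴/20`, `t₁ = 1/poly(L)`: `β⟨F₀⟩_β ≤ 9L⁴ − c` for `β ≥ poly(L)` — `PeriodicSoftness` modulo the Euler field.
[cite: Griffiths1964] [cite: Luscher1983, §2] -/
theorem ring_virial_mean_bound {J : Type*} (s : Finset J)
    {γ : J → ℝ → (Fin (2 * L - 1 + 1) → GaugeConfig 3 L SU2) × (Site 3 L → SU2)} (hγ : ∀ j ∈ s, γ j 0 = 1)
    {φ : J → (Fin (2 * L - 1 + 1) → GaugeConfig 3 L SU2) × (Site 3 L → SU2) → ℝ} (hφm : ∀ j ∈ s, Measurable (φ j))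
    {Cφ : J → ℝ} (hφb : ∀ j ∈ s, ∀ x, |φ j x| ≤ Cφ j)
    {Dφ DF : J → ℝ → (Fin (2 * L - 1 + 1) → GaugeConfig 3 L SU2) × (Site 3 L → SU2) → ℝ} {ε₀ : ℝ} (hε₀ : 0 < ε₀)
    (hDφ : ∀ j ∈ s, ∀ x, ∀ t ∈ ball (0 : ℝ) ε₀, HasDerivAt (fun s' => φ j (x * γ j s')) (Dφ j t x) t)
    (hDF : ∀ j ∈ s, ∀ x, ∀ t ∈ ball (0 : ℝ) ε₀,
      HasDerivAt (fun s' => ringDeficit L (fun _ => false) (x * γ j s')) (DF j t x) t)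
    {Bφ BF : J → ℝ} (hDφb : ∀ j ∈ s, ∀ x, ∀ t ∈ ball (0 : ℝ) ε₀, |Dφ j t x| ≤ Bφ j)
    (hDFb : ∀ j ∈ s, ∀ x, ∀ t ∈ ball (0 : ℝ) ε₀, |DF j t x| ≤ BF j)
    (hDφm : ∀ j ∈ s, StronglyMeasurable (Dφ j 0)) (hDFm : ∀ j ∈ s, StronglyMeasurable (DF j 0)) {β : ℝ} (hβ : 0 ≤ β)
    {E : (Fin (2 * L - 1 + 1) → GaugeConfig 3 L SU2) × (Site 3 L → SU2) → ℝ} (hEm : Measurable E)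
    {t₁ Emax : ℝ} (ht₁ : 0 < t₁) (ht₁2 : t₁ ≤ 2) (hEmax : 0 ≤ Emax) (hE0 : ∀ x, 0 ≤ E x) (hEle : ∀ x, E x ≤ Emax)
    (hEsupp : ∀ x, ringDeficit L (fun _ => false) x < t₁ → E x = 0)
    {D ε : ℝ} (hε : ε < 1)
    (hXF : ∀ x, 2 * (1 - ε) * ringDeficit L (fun _ => false) x - E x ≤ ∑ j ∈ s, φ j x * DF j 0 x)
    (hdiv : ∀ x, ∑ j ∈ s, Dφ j 0 x ≤ D) :
    β * (∫ x, ringDeficit L (fun _ => false) x * Real.exp (-(β * ringDeficit L (fun _ => false) x)) ∂(ringMeasure L)) /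
        (∫ x, Real.exp (-(β * ringDeficit L (fun _ => false) x)) ∂(ringMeasure L)) ≤
      (D + β * (Emax * Real.exp (-(β * t₁ / 2) + 150 * (L : ℝ) ^ 5 * (1 + Real.log (2 / t₁))))) / (2 * (1 - ε)) := by
  have hEb : ∀ x, |E x| ≤ Emax := fun x => by rw [abs_of_nonneg (hE0 x)]; exact hEle x
  have h1 := ring_virial_gibbsMean_le (fun _ => false) s hγ hφm hφb hε₀ hDφ hDF hDφb hDFb hDφm hDFm hβ hEm hEb hε hXF hdiv
  have h2 := ring_gibbsMean_error_le (L := L) hβ ht₁ ht₁2 hEmax hEle hEsupp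
  have h3 : 0 < 2 * (1 - ε) := by linarith
  have h4 : D + β * (∫ x, E x * Real.exp (-(β * ringDeficit L (fun _ => false) x)) ∂(ringMeasure L)) /
        (∫ x, Real.exp (-(β * ringDeficit L (fun _ => false) x)) ∂(ringMeasure L)) ≤
      D + β * (Emax * Real.exp (-(β * t₁ / 2) + 150 * (L : ℝ) ^ 5 * (1 + Real.log (2 / t₁)))) := by
    have h5 := mul_le_mul_of_nonneg_left h2 hβ
    rw [mul_div_assoc]
    linarith
  exact h1.trans (div_le_div_of_nonneg_right h4 h3.le)

end Summit.QuantumFields.YangMills.Theorems.VirialFluxGap.RingIBP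

end
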